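import Summits.NavierStokesRegularity.OSWSelfSimilar.SheetRCertificateWoodbury
import Summits.NavierStokesRegularity.OSWSelfSimilar.CertificateViscousSheetRBSharp
import HarnessLib

/-!
# SHEET-ℝ frame, MODEL ASSEMBLY layer 4f: the assembled certificate under IMPLEMENTATION 2's literals, and the literal-free reading
# «fixed point in a small ball ⇒ MODEL blow-up»

HONEST FRAMING (cell ns-blowup GROUP B / zone Z3, case Z3-SR-CERT; 1-D MODEL certificate (viscous gCLM/OSW sheet on the line at
`(a, c_l, ε) = (1/5, 1/2, 1)`); computer-assisted; not Euler/NS; «violates: none — MODEL»).  Layers 4b–4e are keyed on implementation 1's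
printed primaries (`KNw`, `epsN`, `eta`, radius `rE` of `CertificateViscousSheetR`).  The cell's word of record is «TWO IMPLEMENTATIONS»
(`CertificateViscousSheetRB`: `KNwB`, `epsNBR`, `etaB2`, location literal `rEBR2`).  This file:

* §1 **`modelBlowup_of_fixedPoint`** — the literal-free reading: ANY `δ` with `‖δ‖_E ≤ r`, `δ = −(M∘S₀)(g₀ + Qδδ)` (`S₀` a solution operator of
  `B_λ`, `M` a right inverse of `1 − S₀∘P`, `g₀` representing `G(Ω̄)` weakly) and `|Ω̄(X₀)| > (√2/8)·r` gives a `C²` profile `Ω̄ + prim (der δ)`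
  whose exact self-similar viscous gCLM solution blows up (layer 4c's chain, radius abstracted);
* §2 **implementation 2's column**: `existsUnique_fixedPoint_assembledB` (= `CertificateViscousSheetR.existsUnique_fixedPoint_of_rowBR2_w` on
  `Esp 8`/`W 8` with `Qop`: `‖T g‖ ≤ K_wB‖g‖`, `K_wB = KNwB/(1 − KNwB·epsNBR)`, `‖g₀‖ ≤ etaB2` ⇒ ∃! fixed point with `‖δ‖ ≤ rEBR2`),
  `exists_inverse_of_woodburyB` (the (C2)/(C3) inverse from the capacitance data with the `KNwB`, `epsNBR` bounds, `KNwB·epsNBR < 1` kernel), and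
  **`existsUnique_weakSolutionB`** + **`modelBlowup_of_weakSolutionB`** — the end-to-end MODEL statement keyed on implementation 2's printed constants;
* §3 `fixedPoint_implB_eq_implA` — under both columns' hypotheses the two certified `δ` coincide («two implementations, one zero», assembled).
No definition, no named fact.  WHAT THIS IS NOT: not NS; the numeric hypotheses ARE implementation 2's interval/integer arithmetic of record.
-/

noncomputable section

namespace Summit.NavierStokesRegularity.OSWSelfSimilar
namespace SheetRCertificateAssemblyB

open _root_.MeasureTheory _root_.Set _root_.Filter _root_.Real _root_.Metric _root_.Function Matrix Finset Literature.Analysis.Fourier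
  Literature.Analysis.FluidPDE Literature.Analysis.OperatorTheory SheetRWeakProfilePV SheetRWeakToStrong SheetREnergyClass SheetRWeightedMeasure
  SheetREnergySpace SheetRLinearisedTests SheetRSolutionOperator SheetRAssemblyOperators SheetRCertificateAssembly SheetRCertificateWeakZero
  SheetRCertificateCoercivity SheetRCertificateWoodbury CertificateViscousSheetR
open scoped Topology ENNReal ContDiff BigOperators

/-! ### §1 Fixed point in a small ball ⇒ MODEL blow-up (no literal) -/

section FixedPoint

variable {Ω Ω₁ : ℝ → ℝ} {H₀ : ℝ} (hc : IsCentre 8 Ω Ω₁ H₀) (S₀ : W 8 →L[ℝ] Esp 8 eight_pos)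
  (hS₀ : ∀ (g : W 8) (v v₁ : ℝ → ℝ), IsCompactTest v v₁ →
    linForm 8 (drift (1 / 5) Ω) (potential 8 4 Ω) (prim (der (S₀ g))) (der (S₀ g)) v v₁ = ∫ y, ((8:ℝ) ^ 2 + y ^ 2) * ((g : ℝ → ℝ) y * v y))
  (M : Esp 8 eight_pos →L[ℝ] Esp 8 eight_pos) (hM₁ : ∀ x, M x - S₀ (PopC eight_pos 4 (1 / 5) hc (M x)) = x)
  (g₀ : W 8) {g₀f : ℝ → ℝ} (hg₀f : ((g₀ : W 8) : ℝ → ℝ) =ᵐ[volume] g₀f)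
  (hres : ∀ ψ : ℝ → ℝ, ContDiff ℝ ∞ ψ → HasCompactSupport ψ → (∀ y, ψ (-y) = -ψ y) →
    ∫ x, g₀f x * ψ x = (∫ x, (Ω x + 1 / 2 * x * Ω₁ x + 1 / 5 * (∫ s in (0 : ℝ)..x, hilbertTransform Ω s) * Ω₁ x
      - hilbertTransform Ω x * Ω x) * ψ x) + ∫ x, Ω₁ x * deriv ψ x)

include hc hS₀ hM₁ hg₀f hres in
/-- **Fixed point ⇒ MODEL blow-up, literal-free.**  If `δ = −(M∘S₀)(g₀ + Qδδ)` with `‖δ‖_E ≤ r` and `|Ω̄(X₀)| > (√2/8)·r`, then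
`Ω* = Ω̄ + prim (der δ)` is `C²` and `(T − t)⁻¹Ω*(x/√(T − t))` is a classical solution of `ω_t + (1/5)uω_x = u_xω + ω_xx` on `ℝ × [0,T)` whose sup
norm blows up at `T`, for every `T > 0`. 1-D MODEL; not NS. [folklore] -/
theorem modelBlowup_of_fixedPoint {r : ℝ} {δ : Esp 8 eight_pos} (hball : δ ∈ closedBall (0 : Esp 8 eight_pos) r)
    (hfix : δ = -(M.comp S₀) (g₀ + Qop eight_pos (1 / 5) δ δ)) {X₀ : ℝ} (hX₀ : Real.sqrt 2 / 8 * r < |Ω X₀|) {T : ℝ} (hT : 0 < T) :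
    ContDiff ℝ 2 (fun y => Ω y + prim (der δ) y) ∧
      IsGCLMLineSolution (1 / 5) 1 (gclmSelfSimilar (-1) (1 / 2) T (fun y => Ω y + prim (der δ) y)) T ∧
      SupNormBlowupBefore (gclmSelfSimilar (-1) (1 / 2) T (fun y => Ω y + prim (der δ) y)) T := by
  obtain ⟨hc', hodd, hi, h2, h₁2, hwd, hsup⟩ := profile_facts hc δ
  have hweak : ∀ v v₁ : ℝ → ℝ, IsCompactTest v v₁ →
      linForm 8 (drift (1 / 5) Ω) (potential 8 4 Ω) (prim (der δ)) (der δ) v v₁ =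
        ∫ y, ((8:ℝ) ^ 2 + y ^ 2) * ((PopFun 8 4 (1 / 5) Ω Ω₁ δ y - g₀f y - QFun 8 (1 / 5) δ δ y) * v y) :=
    fun v v₁ hv => linearised_weak_eq_of_fixedPoint hc S₀ hS₀ M hM₁ g₀ hg₀f hfix hv
  have hW := weakZero_of_linearised_weak_eq hc hg₀f hres hweak
  have hne : ¬ (fun y => Ω y + prim (der δ) y) =ᵐ[volume] (0 : ℝ → ℝ) := by
    intro hae
    have h0 : (fun y => Ω y + prim (der δ) y) = 0 := (Continuous.ae_eq_iff_eq volume hc' continuous_const).1 hae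
    have hX : Ω X₀ + prim (der δ) X₀ = 0 := congrFun h0 X₀
    have hδn : ‖δ‖ ≤ r := by rwa [mem_closedBall, dist_zero_right] at hball
    have h1 : |Ω X₀| ≤ Real.sqrt 2 / 8 * ‖δ‖ := by
      rw [show Ω X₀ = -prim (der δ) X₀ by linarith, abs_neg]; exact hsup X₀
    have h2' : Real.sqrt 2 / 8 * ‖δ‖ ≤ Real.sqrt 2 / 8 * r := mul_le_mul_of_nonneg_left hδn (by positivity)
    linarith
  obtain ⟨Ω', hae, -, hC2, hsol, hblow⟩ := SheetRWeakZeroParity.exact_viscous_selfSimilar_blowup_of_weakDeriv_odd (a := 1 / 5) hT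
    one_ne_zero hi h2 h₁2 (Eventually.of_forall hodd) hne hwd hW
  have heq : Ω' = fun y => Ω y + prim (der δ) y := (Continuous.ae_eq_iff_eq volume hC2.continuous hc').1 hae
  subst heq
  exact ⟨hC2, hsol, hblow⟩

end FixedPoint

/-! ### §2 Implementation 2's column -/

/-- **THE ASSEMBLED ROW, implementation 2.**  On `E := Esp 8 _`, `W := W 8` with the sheet's `Qop _ (1/5)`: for any `T : W →L E` with
`‖T g‖ ≤ K_wB‖g‖`, `K_wB = KNwB/(1 − KNwB·epsNBR)`, and any `g₀ ∈ W` with `‖g₀‖ ≤ etaB2`, the closed `E`-ball of radius `rEBR2` about `0` contains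
EXACTLY ONE `δ` with `δ = −T(g₀ + Qδδ)`.  MODEL; the two norm hypotheses are implementation 2's arithmetic of record. [folklore] -/
theorem existsUnique_fixedPoint_assembledB (T : W 8 →L[ℝ] Esp 8 eight_pos)
    (hT : ∀ g, ‖T g‖ ≤ ((KNwB / (1 - KNwB * epsNBR) : ℚ) : ℝ) * ‖g‖) (g₀ : W 8) (hη : ‖g₀‖ ≤ (etaB2 : ℝ)) :
    ∃ δ ∈ closedBall (0 : Esp 8 eight_pos) (rEBR2 : ℝ), δ = -T (g₀ + Qop eight_pos (1 / 5) δ δ) ∧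
      ∀ δ' ∈ closedBall (0 : Esp 8 eight_pos) (rEBR2 : ℝ), δ' = -T (g₀ + Qop eight_pos (1 / 5) δ' δ') → δ' = δ := by
  haveI : CompleteSpace (Esp 8 eight_pos) := completeSpace_Esp eight_pos
  exact existsUnique_fixedPoint_of_rowBR2_w T (Qop eight_pos (1 / 5)) g₀ (Mw_nonneg eight_pos _) hT
    (fun u v => (Qop_apply eight_pos (1 / 5) u v).2) four_Mw_le_Llip hη

section ImplB

variable {Ω Ω₁ : ℝ → ℝ} {H₀ : ℝ} (hc : IsCentre 8 Ω Ω₁ H₀) (hΩ₁ : ContDiff ℝ 1 Ω₁)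
  (hC1 : ∀ ξ, ((8:ℝ) ^ 2 + ξ ^ 2) / 2 + 1 + ξ ^ 2 / 2 + 1 / 5 * ξ * (∫ s in (0 : ℝ)..ξ, hilbertTransform Ω s)
    + (1 / 5) / 2 * ((8:ℝ) ^ 2 + ξ ^ 2) * hilbertTransform Ω ξ ≤ ((8:ℝ) ^ 2 + ξ ^ 2) * potential 8 4 Ω ξ)
  (S₀ : W 8 →L[ℝ] Esp 8 eight_pos)
  (hS₀ : ∀ (g : W 8) (v v₁ : ℝ → ℝ), IsCompactTest v v₁ →
    linForm 8 (drift (1 / 5) Ω) (potential 8 4 Ω) (prim (der (S₀ g))) (der (S₀ g)) v v₁ = ∫ y, ((8:ℝ) ^ 2 + y ^ 2) * ((g : ℝ → ℝ) y * v y))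
  {n : ℕ} (f : Fin n → W 8) (ℓ : Fin n → Esp 8 eight_pos →L[ℝ] ℝ) (Nmat : Matrix (Fin n) (Fin n) ℝ)
  (hN₁ : (1 - capMatrix (fun i => S₀ (f i)) ℓ) * Nmat = 1) (hN₂ : Nmat * (1 - capMatrix (fun i => S₀ (f i)) ℓ) = 1)
  (hKNwB : ∀ g : W 8, ‖capInverse (fun i => S₀ (f i)) ℓ Nmat (S₀ g)‖ ≤ (KNwB : ℝ) * ‖g‖)
  (hepsNB : ∀ u : Esp 8 eight_pos, ‖PopC eight_pos 4 (1 / 5) hc u - ∑ i, ℓ i u • f i‖ ≤ (epsNBR : ℝ) * ‖u‖)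
  (hG : Integrable fun y => ((8:ℝ) ^ 2 + y ^ 2) * (Ω y + 1 / 2 * y * Ω₁ y + 1 / 5 * (∫ s in (0 : ℝ)..y, hilbertTransform Ω s) * Ω₁ y
    - hilbertTransform Ω y * Ω y - deriv Ω₁ y) ^ 2)
  (hηB : Real.sqrt (∫ y, ((8:ℝ) ^ 2 + y ^ 2) * (Ω y + 1 / 2 * y * Ω₁ y + 1 / 5 * (∫ s in (0 : ℝ)..y, hilbertTransform Ω s) * Ω₁ y
    - hilbertTransform Ω y * Ω y - deriv Ω₁ y) ^ 2) ≤ (etaB2 : ℝ))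

include hN₁ hN₂ hKNwB hepsNB in
/-- **Implementation 2's (C2)/(C3) inverse** from the capacitance data with the `KNwB`, `epsNBR` bounds (`KNwB·epsNBR < 1` kernel):
a two-sided inverse `M` of `1 − S₀∘P` with `‖M (S₀ g)‖_E ≤ K_wB‖g‖_w`. [folklore] -/
theorem exists_inverse_of_woodburyB :
    ∃ M : Esp 8 eight_pos →L[ℝ] Esp 8 eight_pos,
      (∀ x, M x - S₀ (PopC eight_pos 4 (1 / 5) hc (M x)) = x) ∧ (∀ x, M (x - S₀ (PopC eight_pos 4 (1 / 5) hc x)) = x) ∧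
      ∀ g, ‖M (S₀ g)‖ ≤ ((KNwB / (1 - KNwB * epsNBR) : ℚ) : ℝ) * ‖g‖ := by
  haveI : CompleteSpace (Esp 8 eight_pos) := completeSpace_Esp eight_pos
  obtain ⟨-, -, -, hK0⟩ := KB_pos_and_etaB_nonneg
  have hε0 : (0 : ℝ) ≤ (epsNBR : ℝ) := by norm_num [epsNBR]
  have h1 : (KNwB : ℝ) * (epsNBR : ℝ) < 1 := by have h := KNwB_mul_epsNBR_lt_one; exact_mod_cast h
  obtain ⟨M, hM₁, hM₂, hK⟩ := exists_twoSided_inverse_one_sub_comp S₀ (PopC eight_pos 4 (1 / 5) hc) f ℓ Nmat hN₁ hN₂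
    (by exact_mod_cast hK0) hε0 hKNwB hepsNB h1
  refine ⟨M, hM₁, hM₂, fun g => ?_⟩
  have e : ((KNwB / (1 - KNwB * epsNBR) : ℚ) : ℝ) = (KNwB : ℝ) / (1 - (KNwB : ℝ) * (epsNBR : ℝ)) := by push_cast; ring
  rw [e]
  exact hK g

include hc hΩ₁ hC1 hS₀ hN₁ hN₂ hKNwB hepsNB hG hηB in
/-- **Implementation 2's printed constants: exactly one weak solution in the `rEBR2`-ball (MODEL).**  Under the pointwise (C1) datum, the
capacitance data with the `KNwB`/`epsNBR` bounds and the residual bound `etaB2`: there is exactly one `δ` with `‖δ‖_E ≤ rEBR2` (5.284e-6) whose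
profile solves the linearised weak equation `linForm(δ; v) = ∫ w·(Pδ − G(Ω̄) − Qδδ)·v` on compactly supported tests.  1-D MODEL; the numeric
hypotheses are implementation 2's arithmetic of record; not NS. [folklore] -/
theorem existsUnique_weakSolutionB :
    ∃! δ : Esp 8 eight_pos, δ ∈ closedBall (0 : Esp 8 eight_pos) (rEBR2 : ℝ) ∧
      ∀ v v₁ : ℝ → ℝ, IsCompactTest v v₁ →
        linForm 8 (drift (1 / 5) Ω) (potential 8 4 Ω) (prim (der δ)) (der δ) v v₁ =
          ∫ y, ((8:ℝ) ^ 2 + y ^ 2) * ((PopFun 8 4 (1 / 5) Ω Ω₁ δ y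
            - (Ω y + 1 / 2 * y * Ω₁ y + 1 / 5 * (∫ s in (0 : ℝ)..y, hilbertTransform Ω s) * Ω₁ y - hilbertTransform Ω y * Ω y - deriv Ω₁ y)
            - QFun 8 (1 / 5) δ δ y) * v y) := by
  obtain ⟨M, hM₁, hM₂, hK⟩ := exists_inverse_of_woodburyB hc S₀ f ℓ Nmat hN₁ hN₂ hKNwB hepsNB
  obtain ⟨hGc, -⟩ := residual_of_contDiff eight_pos (1 / 5) hc hΩ₁
  set g₀ : W 8 := (memLp_W hGc.aestronglyMeasurable hG).toLp _ with hg₀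
  obtain ⟨hg₀ae, hg₀n⟩ := norm_toLp_W eight_pos (memLp_W (L := 8) hGc.aestronglyMeasurable hG)
  have hη' : ‖g₀‖ ≤ (etaB2 : ℝ) := by rw [hg₀, hg₀n]; exact hηB
  obtain ⟨δ, hball, hfix, huniq⟩ := existsUnique_fixedPoint_assembledB (M.comp S₀) (fun g => hK g) g₀ hη'
  have hcoer := fun v v₁ (hv : IsCompactTest v v₁) => coercive_of_pointwise eight_pos 4 (1 / 5) hc hC1 hv
  refine ⟨δ, ⟨hball, fun v v₁ hv => linearised_weak_eq_of_fixedPoint hc S₀ hS₀ M hM₁ g₀ hg₀ae hfix hv⟩, fun δ' hδ' => ?_⟩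
  exact huniq δ' hδ'.1 (eq_fixedPoint_of_linearised_weak_eq hc S₀ hS₀ M hM₂ g₀ hcoer hg₀ae hδ'.2)

include hc hΩ₁ hC1 hS₀ hN₁ hN₂ hKNwB hepsNB hG in
/-- **… and that weak solution's profile blows up (MODEL).**  Every `δ` with `‖δ‖_E ≤ rEBR2` whose profile solves the linearised weak equation
(there is exactly one, `existsUnique_weakSolutionB`) gives, provided `|Ω̄(X₀)| > (√2/8)·rEBR2` at one point, a `C²` profile `Ω* = Ω̄ + prim (der δ)`
whose exact self-similar function `(T − t)⁻¹Ω*(x/√(T − t))` is a classical solution of `ω_t + (1/5)uω_x = u_xω + ω_xx` on `ℝ × [0,T)` with sup norm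
blowing up at `T`, for every `T > 0`.  1-D MODEL, implementation 2's constants; NOT Navier–Stokes. [folklore] -/
theorem modelBlowup_of_weakSolutionB {δ : Esp 8 eight_pos} (hball : δ ∈ closedBall (0 : Esp 8 eight_pos) (rEBR2 : ℝ))
    (hweak : ∀ v v₁ : ℝ → ℝ, IsCompactTest v v₁ →
      linForm 8 (drift (1 / 5) Ω) (potential 8 4 Ω) (prim (der δ)) (der δ) v v₁ =
        ∫ y, ((8:ℝ) ^ 2 + y ^ 2) * ((PopFun 8 4 (1 / 5) Ω Ω₁ δ y
          - (Ω y + 1 / 2 * y * Ω₁ y + 1 / 5 * (∫ s in (0 : ℝ)..y, hilbertTransform Ω s) * Ω₁ y - hilbertTransform Ω y * Ω y - deriv Ω₁ y)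
          - QFun 8 (1 / 5) δ δ y) * v y))
    {X₀ : ℝ} (hX₀ : Real.sqrt 2 / 8 * (rEBR2 : ℝ) < |Ω X₀|) {T : ℝ} (hT : 0 < T) :
    ContDiff ℝ 2 (fun y => Ω y + prim (der δ) y) ∧
      IsGCLMLineSolution (1 / 5) 1 (gclmSelfSimilar (-1) (1 / 2) T (fun y => Ω y + prim (der δ) y)) T ∧
      SupNormBlowupBefore (gclmSelfSimilar (-1) (1 / 2) T (fun y => Ω y + prim (der δ) y)) T := by
  obtain ⟨M, hM₁, hM₂, -⟩ := exists_inverse_of_woodburyB hc S₀ f ℓ Nmat hN₁ hN₂ hKNwB hepsNB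
  obtain ⟨hGc, hres⟩ := residual_of_contDiff eight_pos (1 / 5) hc hΩ₁
  obtain ⟨hg₀ae, -⟩ := norm_toLp_W eight_pos (memLp_W (L := 8) hGc.aestronglyMeasurable hG)
  have hcoer := fun v v₁ (hv : IsCompactTest v v₁) => coercive_of_pointwise eight_pos 4 (1 / 5) hc hC1 hv
  have hfix := eq_fixedPoint_of_linearised_weak_eq hc S₀ hS₀ M hM₂ _ hcoer hg₀ae hweak
  exact modelBlowup_of_fixedPoint hc S₀ hS₀ M hM₁ _ hg₀ae hres hball hfix hX₀ hT

end ImplB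

/-! ### §3 Two implementations, one zero — assembled -/

/-- **The two certified corrections coincide.**  For `T : W →L E` with implementation 1's bound `‖T g‖ ≤ K_w‖g‖` and a residual with
`‖g₀‖ ≤ etaB2` (`≤ eta`): any fixed point in implementation 2's ball (`rEBR2`) — in particular the one of `existsUnique_fixedPoint_assembledB` — IS the
fixed point of implementation 1's column (ball `rE ⊇` ball `rEBR2`, `rEBR2_le_rE`, uniqueness there). [folklore] -/
theorem fixedPoint_implB_eq_implA (T : W 8 →L[ℝ] Esp 8 eight_pos)
    (hT : ∀ g, ‖T g‖ ≤ ((KNw / (1 - KNw * epsN) : ℚ) : ℝ) * ‖g‖)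
    (g₀ : W 8) (hη : ‖g₀‖ ≤ (etaB2 : ℝ)) {δ₁ δ₂ : Esp 8 eight_pos}
    (h₁ : δ₁ ∈ closedBall (0 : Esp 8 eight_pos) (rEBR2 : ℝ)) (h₁' : δ₁ = -T (g₀ + Qop eight_pos (1 / 5) δ₁ δ₁))
    (h₂ : δ₂ ∈ closedBall (0 : Esp 8 eight_pos) (rE : ℝ)) (h₂' : δ₂ = -T (g₀ + Qop eight_pos (1 / 5) δ₂ δ₂)) : δ₁ = δ₂ := by
  have heta : (etaB2 : ℝ) ≤ (eta : ℝ) := by exact_mod_cast etaB2_le_eta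
  have hrr : (rEBR2 : ℝ) ≤ (rE : ℝ) := by exact_mod_cast rEBR2_le_rE
  obtain ⟨δ, -, -, huniq⟩ := existsUnique_fixedPoint_assembled T hT g₀ (hη.trans heta)
  rw [huniq δ₁ (closedBall_subset_closedBall hrr h₁) h₁', huniq δ₂ h₂ h₂']

end SheetRCertificateAssemblyB
end Summit.NavierStokesRegularity.OSWSelfSimilar

end
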